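/-
Copyright: derived here (Resolution Observatory cell `pub-rosobs`, carver gen 50). AI-written Lean; AI review is
weaker than expert review.  Companion file of the cell's POLYNOMIAL weighted-centre model `W(f)`: the grading
bookkeeping of "graded isotropies over `k[σ]`" (README-g49 §NEXT N1 / README-g50 §4 N3; engine 1's (P)-systems are graded
isotropies of a weighted polynomial `G`).
Instrument — NOT a resolution theorem and NOT a statement about the invariant of [AbramovichTemkinWlodarczyk2024].
-/
import Literature.AlgebraicGeometry.Resolution.WeightedCentreIsotropyTwist
import Mathlib.RingTheory.MvPolynomial.WeightedHomogeneous
import Mathlib.Algebra.Polynomial.Degree.Support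
import HarnessLib

/-!
# Graded endomorphisms of `k[ε_ι][σ]` and their closure under the twist operations

Setting: `A₀ = k[ε_ι] = MvPolynomial ι k` with weights `w : ι → M`, the parameter ring `A₀[σ] = A₀[X]` with `deg σ = ρ`.
An element `f = Σ_s f_s σ^s` of `A₀[σ]` is **homogeneous of total weight `n`** (`IsTW w ρ n f`) iff every `σ^s`-coefficient
`f_s ∈ k[ε]` is `w`-weighted-homogeneous of weight `n − s•ρ` (Mathlib `MvPolynomial.IsWeightedHomogeneous`).

A ring endomorphism `Φ` of `A₀[σ]` is **graded** (`IsGradedHom w ρ Φ`) iff it fixes the scalars `k`, sends `σ` to an element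
of total weight `ρ`, and sends each `ε_i` to an element of total weight `w i` — the cell's substitutions
`ε_i ↦ ε_i + Σ_s σ^s·(terms of weight w_i − sρ)`, and also the involution `τ : σ ↦ −σ`.

* `IsTW` is closed under `+`, `Σ`, `*`, `Π`, `^`, negation; `C a` (a weighted-homogeneous), `σ` have the expected weights;
* `IsGradedHom.isTW_map`: a graded endomorphism PRESERVES total weight (`IsTW n f → IsTW n (Φ f)`);
* graded endomorphisms are closed under composition, contain `τ = sigmaNeg`, hence are closed under the twist
  `Φ ↦ Φ_{−σ} = twistConj Φ` and `Φ ↦ Γ_σ = gammaOf Φ = Φ ∘ Φ_{−σ}` of `WeightedCentreIsotropyTwist`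
  (`IsGradedHom.comp/.twistConj/.gammaOf`); with `Φ σ = σ` and `Φ G = G` this gives the closure of GRADED ISOTROPIES of `G`
  (`IsGradedIso.comp/.twistConj/.gammaOf`) — the group-law bookkeeping behind engine 1's (P)-systems;
* `IsGradedHom.smul_eq_of_pureCoeff_ne_zero`: a PURE TERM `c·σ^s` (`c ∈ k`, `c ≠ 0`) in `Φ(ε_i)` forces `s•ρ = w i`
  (the exponent bookkeeping "`j*·ρ' = w(a₀)`" entering H1 of `WeightedCentreBootstrap`).

[ATW24] Abramovich–Temkin–Włodarczyk, Algebra & Number Theory 18 (2024), Thm. 5.3.1 (2)–(3) (p. 1578).  CONTEXT ONLY;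
the bookkeeping is ours.
-/

namespace Literature.AlgebraicGeometry.Resolution.WeightedBlowup

open Polynomial

section TotalWeight

variable {k : Type*} [CommRing k] {ι : Type*} {M : Type*} [AddCommGroup M] {w : ι → M} {ρ : M}

/-- `IsTW w ρ n f`: `f ∈ k[ε][σ]` is homogeneous of total weight `n` — every `σ^s`-coefficient is `w`-weighted-homogeneous
of weight `n − s•ρ` (ours). [cite: AbramovichTemkinWlodarczyk2024, Thm. 5.3.1 (2)–(3) (p. 1578)] -/
def IsTW (w : ι → M) (ρ : M) (n : M) (f : (MvPolynomial ι k)[X]) : Prop :=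
  ∀ s : ℕ, MvPolynomial.IsWeightedHomogeneous w (f.coeff s) (n - s • ρ)

/-- Bookkeeping lemma (ours). [cite: AbramovichTemkinWlodarczyk2024, Thm. 5.3.1 (2)–(3) (p. 1578)] -/
theorem isTW_zero (n : M) : IsTW w ρ n (0 : (MvPolynomial ι k)[X]) := fun s => by
  rw [coeff_zero]; exact MvPolynomial.isWeightedHomogeneous_zero _ _ _

/-- Bookkeeping lemma (ours). [cite: AbramovichTemkinWlodarczyk2024, Thm. 5.3.1 (2)–(3) (p. 1578)] -/
theorem IsTW.add {n : M} {f g : (MvPolynomial ι k)[X]} (hf : IsTW w ρ n f) (hg : IsTW w ρ n g) :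
    IsTW w ρ n (f + g) := fun s => by
  rw [coeff_add]; exact (hf s).add (hg s)

/-- Bookkeeping lemma (ours). [cite: AbramovichTemkinWlodarczyk2024, Thm. 5.3.1 (2)–(3) (p. 1578)] -/
theorem IsTW.neg {n : M} {f : (MvPolynomial ι k)[X]} (hf : IsTW w ρ n f) : IsTW w ρ n (-f) := fun s => by
  rw [coeff_neg]; exact (MvPolynomial.weightedHomogeneousSubmodule k w _).neg_mem (hf s)

/-- Bookkeeping lemma (ours). [cite: AbramovichTemkinWlodarczyk2024, Thm. 5.3.1 (2)–(3) (p. 1578)] -/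
theorem IsTW.sum {α : Type*} (t : Finset α) {n : M} {f : α → (MvPolynomial ι k)[X]}
    (h : ∀ a ∈ t, IsTW w ρ n (f a)) : IsTW w ρ n (∑ a ∈ t, f a) := fun s => by
  rw [finsetSum_coeff]; exact MvPolynomial.IsWeightedHomogeneous.sum t _ _ fun a ha => h a ha s

/-- Total weights add under multiplication (ours). [cite: AbramovichTemkinWlodarczyk2024, Thm. 5.3.1 (2)–(3) (p. 1578)] -/
theorem IsTW.mul {m n : M} {f g : (MvPolynomial ι k)[X]} (hf : IsTW w ρ m f) (hg : IsTW w ρ n g) :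
    IsTW w ρ (m + n) (f * g) := fun s => by
  rw [coeff_mul]
  refine MvPolynomial.IsWeightedHomogeneous.sum _ _ _ fun x hx => ?_
  have h := (hf x.1).mul (hg x.2)
  have hs : x.1 + x.2 = s := Finset.mem_antidiagonal.mp hx
  convert h using 1
  rw [← hs, add_nsmul]
  abel

/-- Bookkeeping lemma (ours): constants. [cite: AbramovichTemkinWlodarczyk2024, Thm. 5.3.1 (2)–(3) (p. 1578)] -/
theorem isTW_C {a : MvPolynomial ι k} {m : M} (ha : MvPolynomial.IsWeightedHomogeneous w a m) :
    IsTW w ρ m (C a) := fun s => by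
  rw [coeff_C]
  split_ifs with h
  · subst h; simpa using ha
  · exact MvPolynomial.isWeightedHomogeneous_zero _ _ _

/-- Bookkeeping lemma (ours). [cite: AbramovichTemkinWlodarczyk2024, Thm. 5.3.1 (2)–(3) (p. 1578)] -/
theorem isTW_one : IsTW w ρ 0 (1 : (MvPolynomial ι k)[X]) := by
  rw [← C_1]; exact isTW_C (MvPolynomial.isWeightedHomogeneous_one k w)

/-- Bookkeeping lemma (ours): `σ` has total weight `ρ`. [cite: AbramovichTemkinWlodarczyk2024, Thm. 5.3.1 (2)–(3) (p. 1578)] -/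
theorem isTW_X : IsTW w ρ ρ (X : (MvPolynomial ι k)[X]) := fun s => by
  rw [coeff_X]
  split_ifs with h
  · subst h; simpa using MvPolynomial.isWeightedHomogeneous_one k w
  · exact MvPolynomial.isWeightedHomogeneous_zero _ _ _

/-- Bookkeeping lemma (ours): products over a finset. [cite: AbramovichTemkinWlodarczyk2024, Thm. 5.3.1 (2)–(3) (p. 1578)] -/
theorem IsTW.prod {α : Type*} (t : Finset α) {n : α → M} {f : α → (MvPolynomial ι k)[X]}
    (h : ∀ a ∈ t, IsTW w ρ (n a) (f a)) : IsTW w ρ (∑ a ∈ t, n a) (∏ a ∈ t, f a) := by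
  classical
  induction t using Finset.induction_on with
  | empty => simpa using (isTW_one : IsTW w ρ 0 (1 : (MvPolynomial ι k)[X]))
  | insert a t ha ih =>
    rw [Finset.prod_insert ha, Finset.sum_insert ha]
    exact (h a (Finset.mem_insert_self a t)).mul (ih fun b hb => h b (Finset.mem_insert_of_mem hb))

/-- Bookkeeping lemma (ours): powers. [cite: AbramovichTemkinWlodarczyk2024, Thm. 5.3.1 (2)–(3) (p. 1578)] -/
theorem IsTW.pow {m : M} {f : (MvPolynomial ι k)[X]} (hf : IsTW w ρ m f) : ∀ n : ℕ, IsTW w ρ (n • m) (f ^ n)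
  | 0 => by rw [pow_zero, zero_smul]; exact isTW_one
  | n + 1 => by rw [pow_succ, succ_nsmul]; exact (IsTW.pow hf n).mul hf

end TotalWeight

section Graded

variable {k : Type*} [CommRing k] {ι : Type*} {M : Type*} [AddCommGroup M] {w : ι → M} {ρ : M}

/-- `Φ : k[ε][σ] → k[ε][σ]` is a GRADED ring endomorphism for the weights `(w, deg σ = ρ)`: it fixes the scalars, `Φ σ` has total
weight `ρ` and `Φ ε_i` has total weight `w i` (ours). [cite: AbramovichTemkinWlodarczyk2024, Thm. 5.3.1 (2)–(3) (p. 1578)] -/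
structure IsGradedHom (w : ι → M) (ρ : M) (Φ : (MvPolynomial ι k)[X] →+* (MvPolynomial ι k)[X]) : Prop where
  /-- scalars are fixed -/
  map_C_C : ∀ c : k, Φ (C (MvPolynomial.C c)) = C (MvPolynomial.C c)
  /-- `Φ σ` is homogeneous of total weight `ρ` -/
  isTW_X : IsTW w ρ ρ (Φ X)
  /-- `Φ ε_i` is homogeneous of total weight `w i` -/
  isTW_CX : ∀ i, IsTW w ρ (w i) (Φ (C (MvPolynomial.X i)))

/-- A graded endomorphism sends a weighted-homogeneous constant `a ∈ k[ε]` of weight `m` to an element of total weight `m`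
(ours). [cite: AbramovichTemkinWlodarczyk2024, Thm. 5.3.1 (2)–(3) (p. 1578)] -/
theorem IsGradedHom.isTW_map_C {Φ : (MvPolynomial ι k)[X] →+* (MvPolynomial ι k)[X]} (hΦ : IsGradedHom w ρ Φ)
    {a : MvPolynomial ι k} {m : M} (ha : MvPolynomial.IsWeightedHomogeneous w a m) : IsTW w ρ m (Φ (C a)) := by
  classical
  rw [a.as_sum, map_sum, map_sum]
  refine IsTW.sum _ fun d hd => ?_
  have hwd : Finsupp.weight w d = m := ha (MvPolynomial.mem_support_iff.mp hd)
  rw [MvPolynomial.monomial_eq, map_mul, map_mul, hΦ.map_C_C, Finsupp.prod]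
  simp only [map_prod, map_pow]
  have h := (isTW_C (ρ := ρ) (MvPolynomial.isWeightedHomogeneous_C w (MvPolynomial.coeff d a))).mul
    (IsTW.prod d.support (n := fun i => d i • w i) fun i _ => (hΦ.isTW_CX i).pow (d i))
  convert h using 2
  rw [zero_add, ← hwd, Finsupp.weight_apply, Finsupp.sum]

/-- **Graded endomorphisms preserve total weight** (ours). [cite: AbramovichTemkinWlodarczyk2024, Thm. 5.3.1 (2)–(3) (p. 1578)] -/
theorem IsGradedHom.isTW_map {Φ : (MvPolynomial ι k)[X] →+* (MvPolynomial ι k)[X]} (hΦ : IsGradedHom w ρ Φ) {n : M}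
    {f : (MvPolynomial ι k)[X]} (hf : IsTW w ρ n f) : IsTW w ρ n (Φ f) := by
  rw [f.as_sum_support_C_mul_X_pow, map_sum]
  refine IsTW.sum _ fun s _ => ?_
  rw [map_mul, map_pow]
  have h := (hΦ.isTW_map_C (hf s)).mul (hΦ.isTW_X.pow s)
  convert h using 2
  rw [sub_add_cancel]

/-- Graded endomorphisms compose (ours). [cite: AbramovichTemkinWlodarczyk2024, Thm. 5.3.1 (2)–(3) (p. 1578)] -/
theorem IsGradedHom.comp {Φ Ψ : (MvPolynomial ι k)[X] →+* (MvPolynomial ι k)[X]} (hΦ : IsGradedHom w ρ Φ)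
    (hΨ : IsGradedHom w ρ Ψ) : IsGradedHom w ρ (Φ.comp Ψ) where
  map_C_C c := by rw [RingHom.comp_apply, hΨ.map_C_C, hΦ.map_C_C]
  isTW_X := by rw [RingHom.comp_apply]; exact hΦ.isTW_map hΨ.isTW_X
  isTW_CX i := by rw [RingHom.comp_apply]; exact hΦ.isTW_map (hΨ.isTW_CX i)

/-- The identity is graded (ours). [cite: AbramovichTemkinWlodarczyk2024, Thm. 5.3.1 (2)–(3) (p. 1578)] -/
theorem isGradedHom_id : IsGradedHom w ρ (RingHom.id (MvPolynomial ι k)[X]) where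
  map_C_C _ := rfl
  isTW_X := isTW_X
  isTW_CX i := isTW_C (MvPolynomial.isWeightedHomogeneous_X k w i)

/-- The involution `τ : σ ↦ −σ` is graded (ours). [cite: AbramovichTemkinWlodarczyk2024, Thm. 5.3.1 (2)–(3) (p. 1578)] -/
theorem isGradedHom_sigmaNeg : IsGradedHom w ρ (sigmaNeg (A₀ := MvPolynomial ι k)).toRingHom where
  map_C_C c := by rw [AlgHom.toRingHom_eq_coe, RingHom.coe_coe, sigmaNeg_C]
  isTW_X := by rw [AlgHom.toRingHom_eq_coe, RingHom.coe_coe, sigmaNeg_X]; exact isTW_X.neg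
  isTW_CX i := by
    rw [AlgHom.toRingHom_eq_coe, RingHom.coe_coe, sigmaNeg_C]; exact isTW_C (MvPolynomial.isWeightedHomogeneous_X k w i)

/-- Graded endomorphisms are closed under the twist `Φ ↦ Φ_{−σ}` (ours). [cite: AbramovichTemkinWlodarczyk2024, Thm. 5.3.1 (2)–(3) (p. 1578)] -/
theorem IsGradedHom.twistConj {Φ : (MvPolynomial ι k)[X] →+* (MvPolynomial ι k)[X]} (hΦ : IsGradedHom w ρ Φ) :
    IsGradedHom w ρ (twistConj Φ) :=
  isGradedHom_sigmaNeg.comp (hΦ.comp isGradedHom_sigmaNeg)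

/-- … and under `Φ ↦ Γ_σ = Φ ∘ Φ_{−σ}` (ours). [cite: AbramovichTemkinWlodarczyk2024, Thm. 5.3.1 (2)–(3) (p. 1578)] -/
theorem IsGradedHom.gammaOf {Φ : (MvPolynomial ι k)[X] →+* (MvPolynomial ι k)[X]} (hΦ : IsGradedHom w ρ Φ) :
    IsGradedHom w ρ (gammaOf Φ) :=
  hΦ.comp hΦ.twistConj

/-- A GRADED ISOTROPY of `G ∈ k[ε]` over `k[σ]` with `deg σ = ρ`: a graded endomorphism with `Φ σ = σ` and `Φ G = G` (ours; the
objects of engine 1's (P)-systems). [cite: AbramovichTemkinWlodarczyk2024, Thm. 5.3.1 (2)–(3) (p. 1578)] -/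
structure IsGradedIso (w : ι → M) (ρ : M) (G : MvPolynomial ι k) (Φ : (MvPolynomial ι k)[X] →+* (MvPolynomial ι k)[X]) :
    Prop where
  /-- graded for `(w, ρ)` -/
  graded : IsGradedHom w ρ Φ
  /-- `k[σ]`-linear -/
  map_X : Φ X = X
  /-- fixes `G` -/
  iso : IsIsotropyOf G Φ

/-- Graded isotropies compose (ours). [cite: AbramovichTemkinWlodarczyk2024, Thm. 5.3.1 (2)–(3) (p. 1578)] -/
theorem IsGradedIso.comp {G : MvPolynomial ι k} {Φ Ψ : (MvPolynomial ι k)[X] →+* (MvPolynomial ι k)[X]}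
    (hΦ : IsGradedIso w ρ G Φ) (hΨ : IsGradedIso w ρ G Ψ) : IsGradedIso w ρ G (Φ.comp Ψ) where
  graded := hΦ.graded.comp hΨ.graded
  map_X := by rw [RingHom.comp_apply, hΨ.map_X, hΦ.map_X]
  iso := hΦ.iso.comp hΨ.iso

/-- … are closed under `Φ ↦ Φ_{−σ}` (ours). [cite: AbramovichTemkinWlodarczyk2024, Thm. 5.3.1 (2)–(3) (p. 1578)] -/
theorem IsGradedIso.twistConj {G : MvPolynomial ι k} {Φ : (MvPolynomial ι k)[X] →+* (MvPolynomial ι k)[X]}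
    (hΦ : IsGradedIso w ρ G Φ) : IsGradedIso w ρ G (twistConj Φ) where
  graded := hΦ.graded.twistConj
  map_X := twistConj_X Φ hΦ.map_X
  iso := hΦ.iso.twistConj

/-- … and under `Φ ↦ Γ_σ` (ours). [cite: AbramovichTemkinWlodarczyk2024, Thm. 5.3.1 (2)–(3) (p. 1578)] -/
theorem IsGradedIso.gammaOf {G : MvPolynomial ι k} {Φ : (MvPolynomial ι k)[X] →+* (MvPolynomial ι k)[X]}
    (hΦ : IsGradedIso w ρ G Φ) : IsGradedIso w ρ G (gammaOf Φ) where
  graded := hΦ.graded.gammaOf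
  map_X := gammaOf_X hΦ.map_X
  iso := hΦ.iso.gammaOf

/-- A graded isotropy preserves total weight (ours). [cite: AbramovichTemkinWlodarczyk2024, Thm. 5.3.1 (2)–(3) (p. 1578)] -/
theorem IsGradedIso.isTW_map {G : MvPolynomial ι k} {Φ : (MvPolynomial ι k)[X] →+* (MvPolynomial ι k)[X]}
    (hΦ : IsGradedIso w ρ G Φ) {n : M} {f : (MvPolynomial ι k)[X]} (hf : IsTW w ρ n f) : IsTW w ρ n (Φ f) :=
  hΦ.graded.isTW_map hf

/-- The PURE COEFFICIENTS of `Φ` in slot `i`: the coefficient of the bare monomial `σ^s` (no `ε`) in `Φ(ε_i)` (ours).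
[cite: AbramovichTemkinWlodarczyk2024, Thm. 5.3.1 (2)–(3) (p. 1578)] -/
noncomputable def pureCoeff (Φ : (MvPolynomial ι k)[X] →+* (MvPolynomial ι k)[X]) (i : ι) (s : ℕ) : k :=
  MvPolynomial.coeff 0 ((Φ (C (MvPolynomial.X i))).coeff s)

/-- **Pure exponents are forced by the grading** (ours): if `Φ` is graded and `Φ(ε_i)` contains the pure monomial `c·σ^s`,
`c ≠ 0`, then `s•ρ = w i` — e.g. the lightest pure term `σ^{j*}` of slot `a₀` has `j*·ρ = w(a₀)`.
[cite: AbramovichTemkinWlodarczyk2024, Thm. 5.3.1 (2)–(3) (p. 1578)] -/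
theorem IsGradedHom.smul_eq_of_pureCoeff_ne_zero {Φ : (MvPolynomial ι k)[X] →+* (MvPolynomial ι k)[X]}
    (hΦ : IsGradedHom w ρ Φ) {i : ι} {s : ℕ} (h : pureCoeff Φ i s ≠ 0) : s • ρ = w i := by
  have h0 : Finsupp.weight w (0 : ι →₀ ℕ) = w i - s • ρ := hΦ.isTW_CX i s h
  rw [map_zero] at h0
  exact (sub_eq_zero.mp h0.symm).symm

/-- In particular two pure exponents of the same slot coincide as multiples of `ρ`, and pure exponents of different slots are
proportional to the weights: `s•ρ = w i`, `s'•ρ = w i'` (ours). [cite: AbramovichTemkinWlodarczyk2024, Thm. 5.3.1 (2)–(3) (p. 1578)] -/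
theorem IsGradedHom.smul_eq_smul_of_pureCoeff_ne_zero {Φ : (MvPolynomial ι k)[X] →+* (MvPolynomial ι k)[X]}
    (hΦ : IsGradedHom w ρ Φ) {i : ι} {s s' : ℕ} (h : pureCoeff Φ i s ≠ 0) (h' : pureCoeff Φ i s' ≠ 0) :
    s • ρ = s' • ρ := by
  rw [hΦ.smul_eq_of_pureCoeff_ne_zero h, hΦ.smul_eq_of_pureCoeff_ne_zero h']

end Graded

end Literature.AlgebraicGeometry.Resolution.WeightedBlowup
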